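import Summits.Langlands.Langlands.Theses.SkinnerWilesDefectOne
import Literature.NumberTheory.Automorphic.OrdinaryCompletedCohomologyGL
import Literature.NumberTheory.GaloisRepresentations.HeckeCharacter
import Summits.Langlands.Langlands.Theorems.SkinnerWilesDefectOneProModularOrdinaryClassicalOrdinaryExit
import Literature.NumberTheory.Automorphic.BianchiBoundaryEigensystemReducible
set_option linter.dupNamespace false

noncomputable section

/-!
# Birth skeleton (BC3) of the split child `OrdinarilyProModularOrdinaryClassical` (X₃, support) of
# `ProModularOrdinaryClassical` (stmt-Langlands-12921), route SkinnerWilesDefectOne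

`X₃` (Skinner–Wiles' exit through Hida's ordinary algebra) is a theorem in print; its line is the landed transfer-free
half of `top-degree-exact-control` (`classical_of_ordinaryPoint`, p96987: central diamond weight + dominance glue + Hida
control + Eichler–Shimura–Harder + Satake dictionary).  Stubs = the two printed named facts it still consumes (Hida
control for dominant ordinary points; interior Bianchi eigenclasses are cuspidal) — boundary reducibility being PROVED
in the tree — and `OrdinarilyProModularOrdinaryClassical_of` is the landed theorem.  `X₃` is stated unfolded.
-/

namespace Summit.Langlands.Langlands.Cruxes.OrdinarilyProModularOrdinaryClassical.Birth

open Summit.Langlands.Langlands.Theses.SkinnerWilesDefectOne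
open Summit.Langlands.Langlands.Cruxes.ProModularOrdinaryClassical.TopDegreeExactControl
open Literature.NumberTheory.Automorphic Literature.NumberTheory.GaloisRepresentations
open NumberField IsDedekindDomain Filter

/-- **Stub 1 — Hida control for dominant ordinary points** (Hida 1994 Thm. 3.2; KT17 §6.4; named fact, XL). -/
theorem stub_hidaControl_dominantOrdinaryPoint :
    Literature.NumberTheory.Automorphic.hidaControl_dominantOrdinaryPoint := by
  sorry

/-- **Stub 2 — interior Bianchi eigenclasses are cuspidal** (Eichler–Shimura–Harder, Harder 1987; named fact, XL). -/
theorem stub_bianchi_interiorEigenclass_isCuspidal :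
    Literature.NumberTheory.Automorphic.bianchi_interiorEigenclass_isCuspidal := by
  sorry

/-- **The child from its two stubs** — the landed exit with boundary reducibility discharged by the tree. [folklore] -/
theorem OrdinarilyProModularOrdinaryClassical_of :
    Literature.NumberTheory.Automorphic.hidaControl_dominantOrdinaryPoint →
    Literature.NumberTheory.Automorphic.bianchi_interiorEigenclass_isCuspidal →
    (∀ (F : Type) [Field F] [NumberField F], NumberField.IsTotallyComplex F → Module.finrank ℚ F = 2 → ∀ (p : ℕ) [Fact p.Prime], p ≠ 2 → ∀ (hcpt : Literature.NumberTheory.Automorphic.isCompact_glFiniteIntegralLevel 2 F) (ι : PadicAlgCl p ≃+* ℂ) (ρ : Literature.NumberTheory.GaloisRepresentations.FramedGaloisRep F (PadicAlgCl p) 2), ρ.toGaloisRep.IsIrreducible → (∃ 𝒰 : Literature.NumberTheory.Automorphic.BigHeckeGLn.TameLevel 2 F p, 𝒰.IsMaximalAbove ∧ ∃ x : Literature.NumberTheory.Automorphic.OrdinaryHeckeAlgebraGLn 𝒰 →+* PadicAlgCl p, Continuous x ∧ 𝒰.IsOrdAssociated x ρ ∧ ∃ N : ℕ, 0 < N ∧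 ∀ (u : NumberField.RingOfIntegers F) (û : ∀ v : IsDedekindDomain.HeightOneSpectrum (NumberField.RingOfIntegers F), (p : NumberField.RingOfIntegers F) ∈ v.asIdeal → (v.adicCompletionIntegers F)ˣ), (∀ (v : IsDedekindDomain.HeightOneSpectrum (NumberField.RingOfIntegers F)) (hv : (p : NumberField.RingOfIntegers F) ∈ v.asIdeal), ((û v hv : v.adicCompletionIntegers F) : v.adicCompletion F) = algebraMap F (v.adicCompletion F) (u : F)) → (∏ᶠ v : {v : IsDedekindDomain.HeightOneSpectrum (NumberField.RingOfIntegers F) // (p : NumberField.RingOfIntegers F) ∈ v.asIdeal}, x (𝒰.ordDiamond v.2 (Pi.mulSingle (0 : Fin 2) (û v.1 v.2)))) ^ N = 1) → (∃ k : ℕ, 2 ≤ k ∧ ∃ m : ℕ, 0 < m ∧ ∀ v : IsDedekindDomain.HeightOneSpectrum (NumberField.RingOfIntegers F), (p : NumberField.RingOfIntegers F) ∈ v.asIdeal → ρ.IsOrdinaryOfWeightAt p v k m) → ∃ π : Literature.NumberTheory.Automorphic.CuspidalAutomorphicRepData 2 F hcpt, π.1.IsLAlgebraic ∧ ∀ᶠ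 v in Filter.cofinite, Summit.Langlands.SatakeFrobCompatibleAt ι π.1 ρ v) :=
  fun hA hB => ordinarilyProModularOrdinaryClassical hA hB
    Literature.NumberTheory.Automorphic.bianchi_boundaryEigensystem_isReducible_holds

/-- Sanity: the composition applied to the stubs concludes the child. [folklore] -/
theorem OrdinarilyProModularOrdinaryClassical_birth :
    ∀ (F : Type) [Field F] [NumberField F], NumberField.IsTotallyComplex F → Module.finrank ℚ F = 2 → ∀ (p : ℕ) [Fact p.Prime], p ≠ 2 → ∀ (hcpt : Literature.NumberTheory.Automorphic.isCompact_glFiniteIntegralLevel 2 F) (ι : PadicAlgCl p ≃+* ℂ) (ρ : Literature.NumberTheory.GaloisRepresentations.FramedGaloisRep F (PadicAlgCl p) 2), ρ.toGaloisRep.IsIrreducible → (∃ 𝒰 : Literature.NumberTheory.Automorphic.BigHeckeGLn.TameLevel 2 F p, 𝒰.IsMaximalAbove ∧ ∃ x : Literature.NumberTheory.Automorphic.OrdinaryHeckeAlgebraGLn 𝒰 →+* PadicAlgCl p, Continuous x ∧ 𝒰.IsOrdAssociated x ρ ∧ ∃ N : ℕ, 0 < N ∧ ∀ (u : NumberField.RingOfIntegers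 F) (û : ∀ v : IsDedekindDomain.HeightOneSpectrum (NumberField.RingOfIntegers F), (p : NumberField.RingOfIntegers F) ∈ v.asIdeal → (v.adicCompletionIntegers F)ˣ), (∀ (v : IsDedekindDomain.HeightOneSpectrum (NumberField.RingOfIntegers F)) (hv : (p : NumberField.RingOfIntegers F) ∈ v.asIdeal), ((û v hv : v.adicCompletionIntegers F) : v.adicCompletion F) = algebraMap F (v.adicCompletion F) (u : F)) → (∏ᶠ v : {v : IsDedekindDomain.HeightOneSpectrum (NumberField.RingOfIntegers F) // (p : NumberField.RingOfIntegers F) ∈ v.asIdeal}, x (𝒰.ordDiamond v.2 (Pi.mulSingle (0 : Fin 2) (û v.1 v.2)))) ^ N = 1) → (∃ k : ℕ, 2 ≤ k ∧ ∃ m : ℕ, 0 < m ∧ ∀ v : IsDedekindDomain.HeightOneSpectrum (NumberField.RingOfIntegers F), (p : NumberField.RingOfIntegers F) ∈ v.asIdeal → ρ.IsOrdinaryOfWeightAt p v k m) → ∃ π : Literature.NumberTheory.Automorphic.CuspidalAutomorphicRepData 2 F hcpt, π.1.IsLAlgebraic ∧ ∀ᶠ v in Filter.cofinite, Summit.Langlands.SatakeFrobCompatibleAt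 ι π.1 ρ v :=
  OrdinarilyProModularOrdinaryClassical_of stub_hidaControl_dominantOrdinaryPoint stub_bianchi_interiorEigenclass_isCuspidal

end Summit.Langlands.Langlands.Cruxes.OrdinarilyProModularOrdinaryClassical.Birth

end
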